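import Summits.BirchSwinnertonDyer.BirchSwinnertonDyer.Theorems.Rank2ShaTierKitW16
import Summits.BirchSwinnertonDyer.BirchSwinnertonDyer.Theorems.Rank2ShaKerPolyCertSound
import HarnessLib

/-!
# BirchSwinnertonDyer — rank-2 `Ш[p^∞]` cell: frame «w16-bound» at `p ≥ 5` with a KERNEL-POLYNOMIAL
# reducibility certificate (`KerPoly.Cert`, ENGINE 3) and a torsion-free certificate

HONEST FRAMING (cell `b2b-bsdr2sha`, run/shared/lean/b2b/bsd-rank2-sha/): per-pair certified
theorems «cited hypotheses ∧ certified computation ⇒ `Ш(E/ℚ)[p^∞]` finite of order dividing `p^k`»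
for rank-2 curves at good ordinary primes; NO claim on BSD in rank `≥ 2`, no class-level theorem,
every published input is a NAMED HYPOTHESIS of the tree (nothing is asserted or minted here).

Cell ruling (46)(a): a census row at a good ordinary `p ≥ 5` with `E[p]` REDUCIBLE and NO rational
point of order `p` (71 cells of the census) is booked under Wuthrich 2014 Thm. 16 once its reducibility
is decided in the kernel by ENGINE 3's kernel-polynomial certificate (`Rank2ShaKerPolyCert*.lean`:
`KerPoly.Cert.check c e p = true` by `decide +kernel`, soundness `KerPoly.red_of_check_baseChange`). This
kit composes that certificate with the cell's base row test (`ShaRow.check`: `p ≥ 5` good ordinary,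
minimal model, exact Tamagawa certificate), the torsion-free certificate `torsFreeCheck` of
`Rank2ShaTierKitW16.lean` (`p ∤ #E(ℚ)_tors` by a good prime), and the tree's adapter
`padicBSD_inequality_of_wuthrich16_odd_of_coeff_ne_zero_of_optimal`:

* `ShaRow.checkWK := check ∧ torsFreeCheck R.e R.p R.sw.l₁ R.sw.sq₁ R.sw.n₁`;
* `ShaRow.w16K` — from `checkWK`, a `KerPoly.Cert` `c` with `c.check R.e R.p = true`, the named facts `hW16`,
  `hS`, `h26`, an EXPLICIT lattice-optimal datum at a level `N ≤ 130000`, the rank certificate, the L-datum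
  and THE canonical height datum: `rank = 2 ∧ Ш(E/ℚ)[p^∞] finite ∧ Reg_p ≠ 0 ∧ ord_p #Ш(E/ℚ)[p^∞] ≤ R.k`
  (torsion term certified `0`); `w16K_eq_one` for `R.k ≤ 0`;
* READERS `booked_w16KOne` (certificate `R.checkWK = true ∧ (∃ c, KerPoly.Cert.check c R.e R.p = true) ∧
  R.k ≤ 0 ∧ 2 ≤ rank`; the `∃` is closed in a tier file by `⟨_, KerPolyCerts.check_<label>_<p>⟩`) and
  `booked_w16KLe`.

References: C. Wuthrich, Doc. Math. 19 (2014), Thm. 16 [Wuthrich2014]; A. Agashe, K. Ribet, W. Stein,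
PAMQ 2 (2006), Thm. 2.6 [AgasheRibetStein2006]; J. H. Silverman, AEC (2009), VII.3.1(b)
[SilvermanAEC2009]; W. Stein, C. Wuthrich, Math. Comp. 82 (2013), Alg. 11.1 [SteinWuthrich2013].
-/

set_option autoImplicit false

-- single-conjunct summit: `Summit.BirchSwinnertonDyer.BirchSwinnertonDyer.…` repeats the name by design
set_option linter.dupNamespace false

noncomputable section

open scoped Classical MatrixGroups ModularForm

open CongruenceSubgroup WeierstrassCurve Literature.NumberTheory.EllipticCurves
  Literature.NumberTheory.EllipticCurves.ModularForms
  Literature.NumberTheory.EllipticCurves.Rank1Residual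
  Summit.BirchSwinnertonDyer.BirchSwinnertonDyer.Rank2Observatory

namespace Summit.BirchSwinnertonDyer.BirchSwinnertonDyer.Rank2Sha

namespace ShaRow

variable (R : ShaRow)

/-- **The kernel test of a `p ≥ 5` row of frame «w16-bound», torsion-free case**: the base test
(`p ≥ 5` good ordinary, minimal model, exact Tamagawa certificate) AND `torsFreeCheck` in the slots
`(l₁, sq₁, n₁)` of `R.sw` (`p ∤ #E(ℚ)_tors`); reducibility comes from a separate kernel-polynomial
certificate. [cite: Wuthrich2014, Thm. 16 (p. 397)] [cite: SilvermanAEC2009, VII.3.1(b)] -/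
def checkWK : Bool := R.check && torsFreeCheck R.e R.p R.sw.l₁ R.sw.sq₁ R.sw.n₁

variable {R}

/-- A row passing `checkWK` passes the base test. [folklore] -/
theorem check_of_checkWK (h : R.checkWK = true) : R.check = true := by
  simp only [checkWK, Bool.and_eq_true] at h; exact h.1

/-- A row passing `checkWK` passes the torsion-free certificate. [folklore] -/
theorem torsFreeCheck_of_checkWK (h : R.checkWK = true) :
    torsFreeCheck R.e R.p R.sw.l₁ R.sw.sq₁ R.sw.n₁ = true := by
  simp only [checkWK, Bool.and_eq_true] at h; exact h.2

/-- From a tier theorem `rows.all checkWK = true` to the test of a member. [folklore] -/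
theorem checkWK_of_all {rows : List ShaRow} (hall : rows.all ShaRow.checkWK = true) {R : ShaRow}
    (hmem : R ∈ rows) : R.checkWK = true :=
  List.all_eq_true.mp hall R hmem

/-- **TIER ROW THEOREM at `p ≥ 5`, frame «w16-bound», kernel-polynomial reducibility.** For a compact row
`R` passing `checkWK` and a kernel-polynomial certificate `c` with `KerPoly.Cert.check c R.e R.p = true`
(ENGINE 3; `E[p]` reducible by `KerPoly.red_of_check_baseChange`), GIVEN `hW16` (Wuthrich 2014 Thm. 16),
`hS` (PRS), `h26` (Agashe–Ribet–Stein Thm. 2.6), an EXPLICIT lattice-optimal parametrisation datum at a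
level `N ≤ 130000`, the rank certificate, the L-datum and THE canonical height datum: `rank_ℤ E(ℚ) = 2`,
`Ш(E/ℚ)[p^∞]` finite, `Reg_p ≠ 0`, `ord_p #Ш(E/ℚ)[p^∞] ≤ R.k` (torsion term certified `0`). Per pair; NOT a
class theorem. [cite: Wuthrich2014, Thm. 16 (p. 397)] [cite: AgasheRibetStein2006, Thm. 2.6]
[cite: BalakrishnanMullerStein2015, Thm. 1.7] [cite: SteinWuthrich2013, §§3–4 and Alg. 11.1] -/
theorem w16K (h : R.checkWK = true) {c : KerPoly.Cert} (hc : KerPoly.Cert.check c R.e R.p = true)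
    [Fact R.p.Prime] [(R.e.baseChange ℚ).IsElliptic] [(R.e.baseChange ℚ).IsGloballyMinimal]
    (hW16 : Wuthrich2014.charIdeal_dvd_padicLFunction) (hS : Schneider1985_order_charGenerator_odd)
    (h26 : AgasheRibetStein2006.cremona_abs_maninConstant_eq_one_of_level_le)
    {N : ℕ} [NeZero N] (D : ModularParametrizationData (R.e.baseChange ℚ) N)
    (hopt : ∀ z ∈ D.L.lattice, ∃ w ∈ periodLattice D.f, z = D.c * w) (hN : N ≤ 130000)
    (hlow : 2 ≤ (R.e.baseChange ℚ).mordellWeilRank)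
    (hLp : PowerSeries.coeff 2 (padicLFunction D.f (unitRoot (R.e.baseChange ℚ) R.p : ℚ_[R.p])) ≠ 0)
    (hcoeff : (PowerSeries.coeff 2
      (padicLFunction D.f (unitRoot (R.e.baseChange ℚ) R.p : ℚ_[R.p]))).valuation = R.a)
    (Dh : PAdicHeightData (R.e.baseChange ℚ) R.p) (hDh : Dh.IsCanonical)
    (hreg : (padicRegulator Dh).valuation = R.b) :
    (R.e.baseChange ℚ).mordellWeilRank = 2 ∧
      Finite (AddCommGroup.primaryComponent (R.e.baseChange ℚ).sha R.p) ∧ SchneiderConjecture Dh ∧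
      (padicValNat R.p (Nat.card (AddCommGroup.primaryComponent (R.e.baseChange ℚ).sha R.p)) : ℤ) ≤
        R.k := by
  have hb := check_of_checkWK h
  have hp2 : R.p ≠ 2 := by have := five_le_of_check hb; omega
  have hordin := isOrdinaryAt_of_check hb
  have hred := KerPoly.red_of_check_baseChange hc
  obtain ⟨hr, hfin, hSch, hle⟩ := padicBSD_inequality_of_wuthrich16_odd_of_coeff_ne_zero_of_optimal
    hW16 hS h26 (R.e.baseChange ℚ) R.p hp2 hordin.1 hordin.2 hred D hopt hN Dh hDh hlow hLp
  haveI := hfin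
  refine ⟨hr, hfin, hSch, ?_⟩
  have hk := padicValNat_card_shaPrimary_le_of_valuation_le (R.e.baseChange ℚ) R.p hp2 hordin D.f
    Dh hSch hLp hle hcoeff hreg
  rw [padicValNat_torsionOrder_eq_zero_of_torsFreeCheck (torsFreeCheck_of_checkWK h),
    reductionPointCount_eq hb, tamagawaProduct_eq hb] at hk
  rw [ShaRow.k]
  push_cast at hk ⊢
  linarith

/-- **`p ≥ 5`, frame «w16-bound» (kernel-polynomial reducibility), `R.k ≤ 0`: `Ш(E/ℚ)[p^∞] = 0`.**
[cite: Wuthrich2014, Thm. 16 (p. 397)] [cite: SteinWuthrich2013, Thm. 1.1 and Alg. 11.1] -/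
theorem w16K_eq_one (h : R.checkWK = true) {c : KerPoly.Cert} (hc : KerPoly.Cert.check c R.e R.p = true)
    [Fact R.p.Prime] [(R.e.baseChange ℚ).IsElliptic] [(R.e.baseChange ℚ).IsGloballyMinimal]
    (hW16 : Wuthrich2014.charIdeal_dvd_padicLFunction) (hS : Schneider1985_order_charGenerator_odd)
    (h26 : AgasheRibetStein2006.cremona_abs_maninConstant_eq_one_of_level_le)
    {N : ℕ} [NeZero N] (D : ModularParametrizationData (R.e.baseChange ℚ) N)
    (hopt : ∀ z ∈ D.L.lattice, ∃ w ∈ periodLattice D.f, z = D.c * w) (hN : N ≤ 130000)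
    (hlow : 2 ≤ (R.e.baseChange ℚ).mordellWeilRank)
    (hLp : PowerSeries.coeff 2 (padicLFunction D.f (unitRoot (R.e.baseChange ℚ) R.p : ℚ_[R.p])) ≠ 0)
    (hcoeff : (PowerSeries.coeff 2
      (padicLFunction D.f (unitRoot (R.e.baseChange ℚ) R.p : ℚ_[R.p]))).valuation = R.a)
    (Dh : PAdicHeightData (R.e.baseChange ℚ) R.p) (hDh : Dh.IsCanonical)
    (hreg : (padicRegulator Dh).valuation = R.b) (hk0 : R.k ≤ 0) :
    (R.e.baseChange ℚ).mordellWeilRank = 2 ∧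
      Finite (AddCommGroup.primaryComponent (R.e.baseChange ℚ).sha R.p) ∧ SchneiderConjecture Dh ∧
      Nat.card (AddCommGroup.primaryComponent (R.e.baseChange ℚ).sha R.p) = 1 := by
  obtain ⟨hr, hfin, hSch, hle⟩ := w16K h hc hW16 hS h26 D hopt hN hlow hLp hcoeff Dh hDh hreg
  haveI := hfin
  have hv0 : padicValNat R.p (Nat.card (AddCommGroup.primaryComponent (R.e.baseChange ℚ).sha R.p)) = 0 := by
    have := hle.trans hk0
    omega
  have hndvd : ¬ R.p ∣ Nat.card (AddCommGroup.primaryComponent (R.e.baseChange ℚ).sha R.p) := by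
    rcases padicValNat.eq_zero_iff.mp hv0 with h1 | h0 | hnd
    · exact absurd h1 (Fact.out : R.p.Prime).one_lt.ne'
    · exact absurd h0 Nat.card_pos.ne'
    · exact hnd
  exact ⟨hr, hfin, hSch, natCard_primaryComponent_eq_one R.p hndvd⟩

/-- **READER at `p ≥ 5`, frame «w16-bound», kernel-polynomial reducibility, V-BOUND 0** («`Ш(E/ℚ)[p^∞] = 0`»):
certificate `R.checkWK = true ∧ (∃ c, KerPoly.Cert.check c R.e R.p = true) ∧ R.k ≤ 0 ∧ 2 ≤ rank` (the `∃`
is closed in a tier file by ENGINE 3's theorem `⟨_, KerPolyCerts.check_<label>_<p>⟩`).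
[cite: Wuthrich2014, Thm. 16 (p. 397)] [cite: AgasheRibetStein2006, Thm. 2.6] [cite: SteinWuthrich2013, Alg. 11.1 and Prop. 11.2] -/
theorem booked_w16KOne
    (h : R.checkWK = true ∧ (∃ c : KerPoly.Cert, KerPoly.Cert.check c R.e R.p = true) ∧ R.k ≤ 0 ∧
      2 ≤ (R.e.baseChange ℚ).mordellWeilRank) :
    haveI : Fact R.p.Prime := ⟨prime_of_check (check_of_checkWK h.1)⟩
    haveI := isElliptic (check_of_checkWK h.1)
    haveI := isGloballyMinimal (check_of_checkWK h.1)
    ∀ (_hW16 : Wuthrich2014.charIdeal_dvd_padicLFunction) (_hS : Schneider1985_order_charGenerator_odd)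
      (_h26 : AgasheRibetStein2006.cremona_abs_maninConstant_eq_one_of_level_le)
      {N : ℕ} [NeZero N] (D : ModularParametrizationData (R.e.baseChange ℚ) N)
      (_hopt : ∀ z ∈ D.L.lattice, ∃ w ∈ periodLattice D.f, z = D.c * w) (_hN : N ≤ 130000)
      (_hLp : PowerSeries.coeff 2 (padicLFunction D.f (unitRoot (R.e.baseChange ℚ) R.p : ℚ_[R.p])) ≠ 0)
      (_hcoeff : (PowerSeries.coeff 2
        (padicLFunction D.f (unitRoot (R.e.baseChange ℚ) R.p : ℚ_[R.p]))).valuation = R.a)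
      (Dh : PAdicHeightData (R.e.baseChange ℚ) R.p) (_hDh : Dh.IsCanonical)
      (_hreg : (padicRegulator Dh).valuation = R.b),
      (R.e.baseChange ℚ).mordellWeilRank = 2 ∧
        Finite (AddCommGroup.primaryComponent (R.e.baseChange ℚ).sha R.p) ∧ SchneiderConjecture Dh ∧
        Nat.card (AddCommGroup.primaryComponent (R.e.baseChange ℚ).sha R.p) = 1 := by
  intro hW16 hS h26 N _ D hopt hN hLp hcoeff Dh hDh hreg
  haveI : Fact R.p.Prime := ⟨prime_of_check (check_of_checkWK h.1)⟩
  haveI := isElliptic (check_of_checkWK h.1)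
  haveI := isGloballyMinimal (check_of_checkWK h.1)
  obtain ⟨c, hc⟩ := h.2.1
  exact w16K_eq_one h.1 hc hW16 hS h26 D hopt hN h.2.2.2 hLp hcoeff Dh hDh hreg h.2.2.1

/-- **READER at `p ≥ 5`, frame «w16-bound», kernel-polynomial reducibility, V-BOUND `b`**: certificate
`R.checkWK = true ∧ (∃ c, KerPoly.Cert.check c R.e R.p = true) ∧ 2 ≤ rank`; conclusion `ord_p #Ш(E/ℚ)[p^∞] ≤ R.k`.
[cite: Wuthrich2014, Thm. 16 (p. 397)] [cite: AgasheRibetStein2006, Thm. 2.6] [cite: SteinWuthrich2013, Alg. 11.1 and Prop. 11.2] -/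
theorem booked_w16KLe
    (h : R.checkWK = true ∧ (∃ c : KerPoly.Cert, KerPoly.Cert.check c R.e R.p = true) ∧
      2 ≤ (R.e.baseChange ℚ).mordellWeilRank) :
    haveI : Fact R.p.Prime := ⟨prime_of_check (check_of_checkWK h.1)⟩
    haveI := isElliptic (check_of_checkWK h.1)
    haveI := isGloballyMinimal (check_of_checkWK h.1)
    ∀ (_hW16 : Wuthrich2014.charIdeal_dvd_padicLFunction) (_hS : Schneider1985_order_charGenerator_odd)
      (_h26 : AgasheRibetStein2006.cremona_abs_maninConstant_eq_one_of_level_le)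
      {N : ℕ} [NeZero N] (D : ModularParametrizationData (R.e.baseChange ℚ) N)
      (_hopt : ∀ z ∈ D.L.lattice, ∃ w ∈ periodLattice D.f, z = D.c * w) (_hN : N ≤ 130000)
      (_hLp : PowerSeries.coeff 2 (padicLFunction D.f (unitRoot (R.e.baseChange ℚ) R.p : ℚ_[R.p])) ≠ 0)
      (_hcoeff : (PowerSeries.coeff 2
        (padicLFunction D.f (unitRoot (R.e.baseChange ℚ) R.p : ℚ_[R.p]))).valuation = R.a)
      (Dh : PAdicHeightData (R.e.baseChange ℚ) R.p) (_hDh : Dh.IsCanonical)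
      (_hreg : (padicRegulator Dh).valuation = R.b),
      (R.e.baseChange ℚ).mordellWeilRank = 2 ∧
        Finite (AddCommGroup.primaryComponent (R.e.baseChange ℚ).sha R.p) ∧ SchneiderConjecture Dh ∧
        (padicValNat R.p (Nat.card (AddCommGroup.primaryComponent (R.e.baseChange ℚ).sha R.p)) : ℤ) ≤
          R.k := by
  intro hW16 hS h26 N _ D hopt hN hLp hcoeff Dh hDh hreg
  haveI : Fact R.p.Prime := ⟨prime_of_check (check_of_checkWK h.1)⟩
  haveI := isElliptic (check_of_checkWK h.1)
  haveI := isGloballyMinimal (check_of_checkWK h.1)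
  obtain ⟨c, hc⟩ := h.2.1
  exact w16K h.1 hc hW16 hS h26 D hopt hN h.2.2 hLp hcoeff Dh hDh hreg

end ShaRow

end Summit.BirchSwinnertonDyer.BirchSwinnertonDyer.Rank2Sha

end
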